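import Mathlib
import Summits.Ventures.PercRepro2.Defs
import Summits.Ventures.PercRepro2.Harris
import Summits.Ventures.PercRepro2.Graph
import Summits.Ventures.PercRepro2.Events
import Summits.Ventures.PercRepro2.Induced
import Summits.Ventures.PercRepro2.BHK
import Summits.Ventures.PercRepro2.BHKEvents
import Summits.Ventures.PercRepro2.VdBKahn
import Summits.Ventures.PercRepro2.BHKAvoid
import Summits.Ventures.PercRepro2.BHKMixed
import Summits.Ventures.PercRepro2.BHKAvoidWeighted
import Summits.Ventures.PercRepro2.BHKMixedAvoid

/-!
# (GEN+) for product events: the contain reduction for every type-− event (PercRepro2, p2)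

Roles `s = a₂`, `t = a₁` (`C_s = H`, `C_t = L`), `Q = {s ↮ t}`, `μ = P(· | Q)`, `U = {s ↔ u}`.
The seat's conjecture (GEN+) (proofs/P2-G15-GENPLUS.md) says that
`Φ = 1[u ∈ C_s]·(1[o ∈ C_s ∪ C_t] − μ(o ∈ C_s ∪ C_t)) − 1[o ∈ C_s]` is negatively correlated with every
event decreasing in `C_t` and increasing in `C_s`; for the product events `W = {C_t ∉ 𝓥} ∩ {C_s ∈ 𝓦}`
(`𝓥, 𝓦` up-sets) this file proves the exact reduction of `PairFormContain.lean` in full generality: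
with `f = −Φ = 1_U·(m − 1[o ∈ C_t]) + 1_{Uᶜ}·1[o ∈ C_s]`, `m = μ(o ∈ C_s ∪ C_t)`,

  `Cov_μ(f, 1_W) = α·Cov_μ(m − 1[o ∈ C_t], 1_W | U) + (1 − α)·Cov_μ(1[o ∈ C_s], 1_W | Uᶜ)
                 + α(1 − α)·(E[f | U] − E[f | Uᶜ])·(μ(W | U) − μ(W | Uᶜ))`,

where the second summand is nonnegative by BHK06 Thm 1.5 under the avoid set `{t, u}`
(`bhk_mixed_cluster_avoid`, BHKMixedAvoid.lean, from `bhk_induced`), and the third by Thm 1.5 under `Q`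
(`bhk_mixed_cluster`) together with two cross-cluster and one same-cluster instance; only the
first — the covariance of `{o ∈ C_t}` and `W` under the law CONDITIONED ON CONTAINING `u` — is
not a BHK instance.  Cleared of denominators (`q = P(Q)`, `aH = P(U, Q)`, `aN = P(Uᶜ, Q)`,
`T_c(W) = P(o ∈ C_t, U, Q)·P(W, U, Q) − P(o ∈ C_t, W, U, Q)·P(U, Q)`):

  `q²·aN·T_c(W) ≤ N_W·aH·aN`  (`genPlus_mul_ge_contain`),  `0 ≤ T_c(W) → 0 ≤ N_W`
  (`genPlus_nonneg_of_contain_nonneg`), `N_W = Cov_μ(f, 1_W)·q³`,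

so (GEN+) holds on every product event `W` on which `Cov_μ(1[o ∈ C_t], 1_W | u ∈ C_s) ≤ 0`
(`W = {b ∉ C_t}` is the pair form of row 2′BETA1, `PairFormContain.lean`).
-/

namespace Summit.Ventures.PercRepro2

section GenPlusContain

variable {V : Type*} {E : Type*} [Fintype E] [DecidableEq E] [Fintype V] [DecidableEq V]
  {R : Type*} [CommRing R] [LinearOrder R] [IsStrictOrderedRing R]

omit [Fintype E] [DecidableEq E] [Fintype V] [DecidableEq V] [LinearOrder R]
  [IsStrictOrderedRing R] in
/-- The algebra of the general contain reduction: with `q = aH + aN`, `wT = wH + wN`,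
`oH = oHH + oHN`, the numerator
`N_W = q·((oL + oH)·wH − q·oLwH + q·oHwN) − ((oL + oH)·aH − q·oLH + q·oHN)·wT` satisfies
`N_W·aH·aN − q²·aN·(oLH·wH − oLwH·aH) = q²·aH·S₁ + S₂·(aN·S₃ + aH·S₄)` with the slacks
`S₁ = oHwN·aN − oHN·wN`, `S₂ = wH·aN − wN·aH`, `S₃ = oL·aH − oLH·q`, `S₄ = oH·aN − oHN·q`. -/
lemma genplus_reduction_identity {q aH aN wT wH wN oL oLH oH oHH oHN oLwH oHwN : R}
    (hq : q = aH + aN) (hw : wT = wH + wN) (ho : oH = oHH + oHN) :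
    (q * ((oL + oH) * wH - q * oLwH + q * oHwN) - ((oL + oH) * aH - q * oLH + q * oHN) * wT)
        * aH * aN - q * q * aN * (oLH * wH - oLwH * aH) =
      q * q * aH * (oHwN * aN - oHN * wN) +
        (wH * aN - wN * aH) * (aN * (oL * aH - oLH * q) + aH * (oH * aN - oHN * q)) := by
  subst hq hw ho
  ring

omit [Fintype E] [DecidableEq E] [Fintype V] [DecidableEq V] in
/-- The general contain reduction, algebraic form: from the BHK instances `oHN·wN ≤ oHwN·aN`
(mixed, avoiding `u`), `aH·wT ≤ wH·q` (mixed), `oLH·q ≤ aH·oL`, `oH·aH ≤ oHH·q` and the splits,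
`q²·aN·(oLH·wH − oLwH·aH) ≤ N_W·aH·aN`. -/
lemma genplus_reduction_algebra {q aH aN wT wH wN oL oLH oH oHH oHN oLwH oHwN : R}
    (haH : 0 ≤ aH) (haN : 0 ≤ aN) (hq : q = aH + aN) (hw : wT = wH + wN) (ho : oH = oHH + oHN)
    (h1 : oHN * wN ≤ oHwN * aN) (h2 : aH * wT ≤ wH * q) (h3 : oLH * q ≤ aH * oL)
    (h4 : oH * aH ≤ oHH * q) :
    q * q * aN * (oLH * wH - oLwH * aH) ≤
      (q * ((oL + oH) * wH - q * oLwH + q * oHwN) - ((oL + oH) * aH - q * oLH + q * oHN) * wT)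
        * aH * aN := by
  have key := genplus_reduction_identity hq hw ho (oL := oL) (oLH := oLH) (oLwH := oLwH)
    (oHwN := oHwN)
  have hS1 : 0 ≤ oHwN * aN - oHN * wN := by linarith
  have hS2 : 0 ≤ wH * aN - wN * aH := by
    have : aH * (wH + wN) ≤ wH * (aH + aN) := by rw [← hw, ← hq]; exact h2
    linarith
  have hS3 : 0 ≤ oL * aH - oLH * q := by linarith
  have hS4 : 0 ≤ oH * aN - oHN * q := by
    have : (oHH + oHN) * aH ≤ oHH * (aH + aN) := by rw [← ho, ← hq]; exact h4
    rw [ho, hq]; linarith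
  have hq0 : 0 ≤ q := by rw [hq]; exact add_nonneg haH haN
  have t1 : 0 ≤ q * q * aH * (oHwN * aN - oHN * wN) :=
    mul_nonneg (mul_nonneg (mul_nonneg hq0 hq0) haH) hS1
  have t2 : 0 ≤ (wH * aN - wN * aH) * (aN * (oL * aH - oLH * q) + aH * (oH * aN - oHN * q)) :=
    mul_nonneg hS2 (add_nonneg (mul_nonneg haN hS3) (mul_nonneg haH hS4))
  linarith

omit [Fintype E] [DecidableEq E] [Fintype V] [DecidableEq V] [LinearOrder R]
  [IsStrictOrderedRing R] in
/-- Degenerate case `P(u ∉ C_s, Q) = 0`: `N_W = q · (oLH·wH − oLwH·aH)`. -/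
lemma genplus_reduction_degenerate {q aH aN wT wH wN oL oLH oH oHH oHN oLwH oHwN : R}
    (hq : q = aH + aN) (hw : wT = wH + wN) (ho : oH = oHH + oHN) (haN : aN = 0) (hwN : wN = 0)
    (hoHN : oHN = 0) (hoHwN : oHwN = 0) :
    q * ((oL + oH) * wH - q * oLwH + q * oHwN) - ((oL + oH) * aH - q * oLH + q * oHN) * wT =
      q * (oLH * wH - oLwH * aH) := by
  subst hq hw ho haN hwN hoHN hoHwN
  ring

omit [Fintype E] [DecidableEq E] [Fintype V] [DecidableEq V] [LinearOrder R]
  [IsStrictOrderedRing R] in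
/-- Degenerate case `P(u ∈ C_s, Q) = 0`: `N_W = q · (q·oHwN − oHN·wN)`, the mixed BHK slack. -/
lemma genplus_reduction_degenerate' {q aH wT wH wN oL oLH oH oHN oLwH oHwN : R}
    (hw : wT = wH + wN) (haH : aH = 0) (hwH : wH = 0) (hoLH : oLH = 0) (hoLwH : oLwH = 0) :
    q * ((oL + oH) * wH - q * oLwH + q * oHwN) - ((oL + oH) * aH - q * oLH + q * oHN) * wT =
      q * (q * oHwN - oHN * wN) := by
  subst hw haH hwH hoLH hoLwH
  ring

/-- **The contain reduction of (GEN+) on product events** (multiplied out).  With `Q = {s ↮ t}`,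
`U = {s ↔ u}`, `Q_u = Q ∩ Uᶜ`, `O' = {o ∈ C_t}`, `O = {o ∈ C_s}`, `W = {C_t ∉ 𝓥} ∩ {C_s ∈ 𝓦}`,
`q = P(Q)`, `aH = P(U, Q)`, `aN = P(Q_u)`, `wH = P(W, U, Q)`, `wN = P(W, Q_u)`, `wT = P(W, Q)`,
`oL = P(O', Q)`, `oLH = P(U, O', Q)`, `oH = P(O, Q)`, `oHN = P(O, Q_u)`, `oLwH = P(O', W, U, Q)`,
`oHwN = P(O, W, Q_u)`:

  `q²·aN·(oLH·wH − oLwH·aH) ≤ N_W·aH·aN`,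
  `N_W = q·((oL + oH)·wH − q·oLwH + q·oHwN) − ((oL + oH)·aH − q·oLH + q·oHN)·wT = Cov_μ(f, 1_W)·q³`,

`f = 1_U·(μ(o ∈ C_s ∪ C_t) − 1_{O'}) + 1_{Uᶜ}·1_O = −Φ`; the difference is the nonnegative
combination `q²·aH·S₁ + S₂·(aN·S₃ + aH·S₄)` of four BHK slacks. -/
theorem genPlus_mul_ge_contain (p : E → R) (hp : IsProbVec p) (ends : E → Sym2 V) (s t u o : V)
    {𝓥 𝓦 : Set (Set V)} (h𝓥 : IsUpperSet 𝓥) (h𝓦 : IsUpperSet 𝓦) :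
    prob p (connEvent ends s t)ᶜ * prob p (connEvent ends s t)ᶜ *
        prob p ((connEvent ends s t)ᶜ ∩ (connEvent ends s u)ᶜ) *
        (prob p (connEvent ends s u ∩ clusterInEvent ends t {W : Set V | o ∈ W} ∩
              (connEvent ends s t)ᶜ) *
            prob p ((clusterInEvent ends t 𝓥)ᶜ ∩ clusterInEvent ends s 𝓦 ∩ connEvent ends s u ∩
              (connEvent ends s t)ᶜ) -
          prob p (clusterInEvent ends t {W : Set V | o ∈ W} ∩
              ((clusterInEvent ends t 𝓥)ᶜ ∩ clusterInEvent ends s 𝓦) ∩ connEvent ends s u ∩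
              (connEvent ends s t)ᶜ) *
            prob p (connEvent ends s u ∩ (connEvent ends s t)ᶜ)) ≤
      (prob p (connEvent ends s t)ᶜ *
          ((prob p (clusterInEvent ends t {W : Set V | o ∈ W} ∩ (connEvent ends s t)ᶜ) +
              prob p (clusterInEvent ends s {W : Set V | o ∈ W} ∩ (connEvent ends s t)ᶜ)) *
            prob p ((clusterInEvent ends t 𝓥)ᶜ ∩ clusterInEvent ends s 𝓦 ∩ connEvent ends s u ∩
              (connEvent ends s t)ᶜ) -
          prob p (connEvent ends s t)ᶜ *
            prob p (clusterInEvent ends t {W : Set V | o ∈ W} ∩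
              ((clusterInEvent ends t 𝓥)ᶜ ∩ clusterInEvent ends s 𝓦) ∩ connEvent ends s u ∩
              (connEvent ends s t)ᶜ) +
          prob p (connEvent ends s t)ᶜ *
            prob p (clusterInEvent ends s ({W : Set V | o ∈ W} ∩ 𝓦) ∩ (clusterInEvent ends t 𝓥)ᶜ ∩
              ((connEvent ends s t)ᶜ ∩ (connEvent ends s u)ᶜ))) -
        ((prob p (clusterInEvent ends t {W : Set V | o ∈ W} ∩ (connEvent ends s t)ᶜ) +
              prob p (clusterInEvent ends s {W : Set V | o ∈ W} ∩ (connEvent ends s t)ᶜ)) *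
            prob p (connEvent ends s u ∩ (connEvent ends s t)ᶜ) -
          prob p (connEvent ends s t)ᶜ *
            prob p (connEvent ends s u ∩ clusterInEvent ends t {W : Set V | o ∈ W} ∩
              (connEvent ends s t)ᶜ) +
          prob p (connEvent ends s t)ᶜ *
            prob p (clusterInEvent ends s {W : Set V | o ∈ W} ∩
              ((connEvent ends s t)ᶜ ∩ (connEvent ends s u)ᶜ))) *
        prob p ((clusterInEvent ends t 𝓥)ᶜ ∩ clusterInEvent ends s 𝓦 ∩ (connEvent ends s t)ᶜ)) *
        prob p (connEvent ends s u ∩ (connEvent ends s t)ᶜ) *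
        prob p ((connEvent ends s t)ᶜ ∩ (connEvent ends s u)ᶜ) := by
  classical
  have hU : clusterInEvent ends s {W : Set V | u ∈ W} = connEvent ends s u :=
    clusterInEvent_memFamily_eq_connEvent ends s u
  -- (B1) mixed, avoiding `u`: `oHN · wN ≤ oHwN · aN`
  have h1 := bhk_mixed_cluster_avoid p hp ends s t (X := {t, u}) (by simp)
    (isUpperSet_memFamily o) h𝓦 h𝓥
  rw [avoidAll_pair] at h1
  -- (B2) mixed under `Q`: `aH · wT ≤ wH · q`
  have h2 := BHKMixed.bhk_mixed_cluster p hp ends s t (isUpperSet_memFamily u) h𝓦 h𝓥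
  rw [hU] at h2
  -- (B3) cross clusters: `oLH · q ≤ aH · oL`
  have h3 := bhk_cross_cluster p hp ends s t (isUpperSet_memFamily u) (isUpperSet_memFamily o)
  rw [hU] at h3
  -- (B4) same cluster: `oH · aH ≤ oHH · q`
  have h4 := bhk_same_cluster_events p hp ends s t (isUpperSet_memFamily o)
    (isUpperSet_memFamily u)
  rw [hU] at h4
  -- the splits
  have hq := prob_inter_add_prob_inter_compl p (connEvent ends s t)ᶜ (connEvent ends s u)
  have eq1 : (connEvent ends s t)ᶜ ∩ connEvent ends s u =
      connEvent ends s u ∩ (connEvent ends s t)ᶜ := Set.inter_comm _ _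
  rw [eq1] at hq
  have hw := prob_inter_add_prob_inter_compl p
    ((clusterInEvent ends t 𝓥)ᶜ ∩ clusterInEvent ends s 𝓦 ∩ (connEvent ends s t)ᶜ)
    (connEvent ends s u)
  have ew1 : (clusterInEvent ends t 𝓥)ᶜ ∩ clusterInEvent ends s 𝓦 ∩ (connEvent ends s t)ᶜ ∩
      connEvent ends s u =
      (clusterInEvent ends t 𝓥)ᶜ ∩ clusterInEvent ends s 𝓦 ∩ connEvent ends s u ∩
        (connEvent ends s t)ᶜ := by
    ext ω; simp only [Set.mem_inter_iff]; tauto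
  have ew2 : (clusterInEvent ends t 𝓥)ᶜ ∩ clusterInEvent ends s 𝓦 ∩ (connEvent ends s t)ᶜ ∩
      (connEvent ends s u)ᶜ =
      clusterInEvent ends s 𝓦 ∩ (clusterInEvent ends t 𝓥)ᶜ ∩
        ((connEvent ends s t)ᶜ ∩ (connEvent ends s u)ᶜ) := by
    ext ω; simp only [Set.mem_inter_iff, Set.mem_compl_iff]; tauto
  rw [ew1, ew2] at hw
  have ho := prob_inter_add_prob_inter_compl p
    (clusterInEvent ends s {W : Set V | o ∈ W} ∩ (connEvent ends s t)ᶜ) (connEvent ends s u)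
  have eo1 : clusterInEvent ends s {W : Set V | o ∈ W} ∩ (connEvent ends s t)ᶜ ∩
      connEvent ends s u =
      clusterInEvent ends s {W : Set V | o ∈ W} ∩ connEvent ends s u ∩ (connEvent ends s t)ᶜ := by
    ext ω; simp only [Set.mem_inter_iff]; tauto
  have eo2 : clusterInEvent ends s {W : Set V | o ∈ W} ∩ (connEvent ends s t)ᶜ ∩
      (connEvent ends s u)ᶜ =
      clusterInEvent ends s {W : Set V | o ∈ W} ∩
        ((connEvent ends s t)ᶜ ∩ (connEvent ends s u)ᶜ) := Set.inter_assoc _ _ _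
  rw [eo1, eo2] at ho
  -- the mixed event under `Q`, in the shape of (B2): `{C_s ∈ {u} ∩ 𝓦}` vs `U ∩ W`
  have e2 : clusterInEvent ends s ({W : Set V | u ∈ W} ∩ 𝓦) ∩ (clusterInEvent ends t 𝓥)ᶜ ∩
      (connEvent ends s t)ᶜ =
      (clusterInEvent ends t 𝓥)ᶜ ∩ clusterInEvent ends s 𝓦 ∩ connEvent ends s u ∩
        (connEvent ends s t)ᶜ := by
    rw [← BHKMixed.clusterInEvent_inter, hU]
    ext ω; simp only [Set.mem_inter_iff, Set.mem_compl_iff]; tauto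
  have e2' : clusterInEvent ends s 𝓦 ∩ (clusterInEvent ends t 𝓥)ᶜ ∩ (connEvent ends s t)ᶜ =
      (clusterInEvent ends t 𝓥)ᶜ ∩ clusterInEvent ends s 𝓦 ∩ (connEvent ends s t)ᶜ := by
    ext ω; simp only [Set.mem_inter_iff]; tauto
  rw [e2, e2'] at h2
  -- (B1) in the shape of the masses
  have e1 : clusterInEvent ends s 𝓦 ∩ (clusterInEvent ends t 𝓥)ᶜ ∩
      ((connEvent ends s t)ᶜ ∩ (connEvent ends s u)ᶜ) =
      clusterInEvent ends s 𝓦 ∩ (clusterInEvent ends t 𝓥)ᶜ ∩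
        ((connEvent ends s t)ᶜ ∩ (connEvent ends s u)ᶜ) := rfl
  rw [e1] at h1
  exact genplus_reduction_algebra (prob_nonneg hp _) (prob_nonneg hp _) hq.symm hw.symm ho.symm
    h1 h2 h3 h4

/-- **(GEN+) on a product event ⟸ contain-conditioned negative correlation.** If
`Cov_μ(1[o ∈ C_t], 1_W | u ∈ C_s) ≤ 0` (`0 ≤ T_c(W)`) then `Cov_μ(Φ, 1_W) ≤ 0`, i.e. `0 ≤ N_W`;
the degenerate cases `P(u ∈ C_s, Q) = 0` (`N_W = q·(q·P(O,W,Q_u) − P(O,Q_u)·P(W,Q_u))`, the mixed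
BHK slack) and `P(u ∉ C_s, Q) = 0` (`N_W = q·T_c(W)`) included. -/
theorem genPlus_nonneg_of_contain_nonneg (p : E → R) (hp : IsProbVec p) (ends : E → Sym2 V)
    (s t u o : V) {𝓥 𝓦 : Set (Set V)} (h𝓥 : IsUpperSet 𝓥) (h𝓦 : IsUpperSet 𝓦)
    (hc : 0 ≤ (prob p (connEvent ends s u ∩ clusterInEvent ends t {W : Set V | o ∈ W} ∩
              (connEvent ends s t)ᶜ) *
            prob p ((clusterInEvent ends t 𝓥)ᶜ ∩ clusterInEvent ends s 𝓦 ∩ connEvent ends s u ∩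
              (connEvent ends s t)ᶜ) -
          prob p (clusterInEvent ends t {W : Set V | o ∈ W} ∩
              ((clusterInEvent ends t 𝓥)ᶜ ∩ clusterInEvent ends s 𝓦) ∩ connEvent ends s u ∩
              (connEvent ends s t)ᶜ) *
            prob p (connEvent ends s u ∩ (connEvent ends s t)ᶜ))) :
    0 ≤ (prob p (connEvent ends s t)ᶜ *
          ((prob p (clusterInEvent ends t {W : Set V | o ∈ W} ∩ (connEvent ends s t)ᶜ) +
              prob p (clusterInEvent ends s {W : Set V | o ∈ W} ∩ (connEvent ends s t)ᶜ)) *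
            prob p ((clusterInEvent ends t 𝓥)ᶜ ∩ clusterInEvent ends s 𝓦 ∩ connEvent ends s u ∩
              (connEvent ends s t)ᶜ) -
          prob p (connEvent ends s t)ᶜ *
            prob p (clusterInEvent ends t {W : Set V | o ∈ W} ∩
              ((clusterInEvent ends t 𝓥)ᶜ ∩ clusterInEvent ends s 𝓦) ∩ connEvent ends s u ∩
              (connEvent ends s t)ᶜ) +
          prob p (connEvent ends s t)ᶜ *
            prob p (clusterInEvent ends s ({W : Set V | o ∈ W} ∩ 𝓦) ∩ (clusterInEvent ends t 𝓥)ᶜ ∩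
              ((connEvent ends s t)ᶜ ∩ (connEvent ends s u)ᶜ))) -
        ((prob p (clusterInEvent ends t {W : Set V | o ∈ W} ∩ (connEvent ends s t)ᶜ) +
              prob p (clusterInEvent ends s {W : Set V | o ∈ W} ∩ (connEvent ends s t)ᶜ)) *
            prob p (connEvent ends s u ∩ (connEvent ends s t)ᶜ) -
          prob p (connEvent ends s t)ᶜ *
            prob p (connEvent ends s u ∩ clusterInEvent ends t {W : Set V | o ∈ W} ∩
              (connEvent ends s t)ᶜ) +
          prob p (connEvent ends s t)ᶜ *
            prob p (clusterInEvent ends s {W : Set V | o ∈ W} ∩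
              ((connEvent ends s t)ᶜ ∩ (connEvent ends s u)ᶜ))) *
        prob p ((clusterInEvent ends t 𝓥)ᶜ ∩ clusterInEvent ends s 𝓦 ∩ (connEvent ends s t)ᶜ)) := by
  classical
  have main := genPlus_mul_ge_contain p hp ends s t u o h𝓥 h𝓦
  have hq0 : 0 ≤ prob p (connEvent ends s t)ᶜ := prob_nonneg hp _
  have haH0 : 0 ≤ prob p (connEvent ends s u ∩ (connEvent ends s t)ᶜ) := prob_nonneg hp _
  have haN0 : 0 ≤ prob p ((connEvent ends s t)ᶜ ∩ (connEvent ends s u)ᶜ) := prob_nonneg hp _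
  have hq := prob_inter_add_prob_inter_compl p (connEvent ends s t)ᶜ (connEvent ends s u)
  have eq1 : (connEvent ends s t)ᶜ ∩ connEvent ends s u =
      connEvent ends s u ∩ (connEvent ends s t)ᶜ := Set.inter_comm _ _
  rw [eq1] at hq
  have hw := prob_inter_add_prob_inter_compl p
    ((clusterInEvent ends t 𝓥)ᶜ ∩ clusterInEvent ends s 𝓦 ∩ (connEvent ends s t)ᶜ)
    (connEvent ends s u)
  have ew1 : (clusterInEvent ends t 𝓥)ᶜ ∩ clusterInEvent ends s 𝓦 ∩ (connEvent ends s t)ᶜ ∩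
      connEvent ends s u =
      (clusterInEvent ends t 𝓥)ᶜ ∩ clusterInEvent ends s 𝓦 ∩ connEvent ends s u ∩
        (connEvent ends s t)ᶜ := by
    ext ω; simp only [Set.mem_inter_iff]; tauto
  have ew2 : (clusterInEvent ends t 𝓥)ᶜ ∩ clusterInEvent ends s 𝓦 ∩ (connEvent ends s t)ᶜ ∩
      (connEvent ends s u)ᶜ =
      clusterInEvent ends s 𝓦 ∩ (clusterInEvent ends t 𝓥)ᶜ ∩
        ((connEvent ends s t)ᶜ ∩ (connEvent ends s u)ᶜ) := by
    ext ω; simp only [Set.mem_inter_iff, Set.mem_compl_iff]; tauto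
  rw [ew1, ew2] at hw
  have ho := prob_inter_add_prob_inter_compl p
    (clusterInEvent ends s {W : Set V | o ∈ W} ∩ (connEvent ends s t)ᶜ) (connEvent ends s u)
  have eo1 : clusterInEvent ends s {W : Set V | o ∈ W} ∩ (connEvent ends s t)ᶜ ∩
      connEvent ends s u =
      clusterInEvent ends s {W : Set V | o ∈ W} ∩ connEvent ends s u ∩ (connEvent ends s t)ᶜ := by
    ext ω; simp only [Set.mem_inter_iff]; tauto
  have eo2 : clusterInEvent ends s {W : Set V | o ∈ W} ∩ (connEvent ends s t)ᶜ ∩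
      (connEvent ends s u)ᶜ =
      clusterInEvent ends s {W : Set V | o ∈ W} ∩
        ((connEvent ends s t)ᶜ ∩ (connEvent ends s u)ᶜ) := Set.inter_assoc _ _ _
  rw [eo1, eo2] at ho
  rcases haN0.lt_or_eq with haNpos | haNzero
  · rcases haH0.lt_or_eq with haHpos | haHzero
    · -- generic: divide by `aH · aN > 0`
      have hlhs : 0 ≤ prob p (connEvent ends s t)ᶜ * prob p (connEvent ends s t)ᶜ *
          prob p ((connEvent ends s t)ᶜ ∩ (connEvent ends s u)ᶜ) * (prob p (connEvent ends s u ∩ clusterInEvent ends t {W : Set V | o ∈ W} ∩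
              (connEvent ends s t)ᶜ) *
            prob p ((clusterInEvent ends t 𝓥)ᶜ ∩ clusterInEvent ends s 𝓦 ∩ connEvent ends s u ∩
              (connEvent ends s t)ᶜ) -
          prob p (clusterInEvent ends t {W : Set V | o ∈ W} ∩
              ((clusterInEvent ends t 𝓥)ᶜ ∩ clusterInEvent ends s 𝓦) ∩ connEvent ends s u ∩
              (connEvent ends s t)ᶜ) *
            prob p (connEvent ends s u ∩ (connEvent ends s t)ᶜ)) :=
        mul_nonneg (mul_nonneg (mul_nonneg hq0 hq0) haN0) hc
      have hprod : 0 ≤ (prob p (connEvent ends s t)ᶜ *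
          ((prob p (clusterInEvent ends t {W : Set V | o ∈ W} ∩ (connEvent ends s t)ᶜ) +
              prob p (clusterInEvent ends s {W : Set V | o ∈ W} ∩ (connEvent ends s t)ᶜ)) *
            prob p ((clusterInEvent ends t 𝓥)ᶜ ∩ clusterInEvent ends s 𝓦 ∩ connEvent ends s u ∩
              (connEvent ends s t)ᶜ) -
          prob p (connEvent ends s t)ᶜ *
            prob p (clusterInEvent ends t {W : Set V | o ∈ W} ∩
              ((clusterInEvent ends t 𝓥)ᶜ ∩ clusterInEvent ends s 𝓦) ∩ connEvent ends s u ∩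
              (connEvent ends s t)ᶜ) +
          prob p (connEvent ends s t)ᶜ *
            prob p (clusterInEvent ends s ({W : Set V | o ∈ W} ∩ 𝓦) ∩ (clusterInEvent ends t 𝓥)ᶜ ∩
              ((connEvent ends s t)ᶜ ∩ (connEvent ends s u)ᶜ))) -
        ((prob p (clusterInEvent ends t {W : Set V | o ∈ W} ∩ (connEvent ends s t)ᶜ) +
              prob p (clusterInEvent ends s {W : Set V | o ∈ W} ∩ (connEvent ends s t)ᶜ)) *
            prob p (connEvent ends s u ∩ (connEvent ends s t)ᶜ) -
          prob p (connEvent ends s t)ᶜ *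
            prob p (connEvent ends s u ∩ clusterInEvent ends t {W : Set V | o ∈ W} ∩
              (connEvent ends s t)ᶜ) +
          prob p (connEvent ends s t)ᶜ *
            prob p (clusterInEvent ends s {W : Set V | o ∈ W} ∩
              ((connEvent ends s t)ᶜ ∩ (connEvent ends s u)ᶜ))) *
        prob p ((clusterInEvent ends t 𝓥)ᶜ ∩ clusterInEvent ends s 𝓦 ∩ (connEvent ends s t)ᶜ)) *
          (prob p (connEvent ends s u ∩ (connEvent ends s t)ᶜ) *
            prob p ((connEvent ends s t)ᶜ ∩ (connEvent ends s u)ᶜ)) := by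
        rw [← mul_assoc]; linarith
      exact nonneg_of_mul_nonneg_left hprod (mul_pos haHpos haNpos)
    · -- `P(u ∈ C_s, Q) = 0`: the masses inside `U ∩ Q` vanish; `N_W = q · S₁`
      have vanish : ∀ A : Set (Config E), A ⊆ connEvent ends s u ∩ (connEvent ends s t)ᶜ →
          prob p A = 0 := fun A hA =>
        le_antisymm (haHzero ▸ prob_mono hp hA) (prob_nonneg hp A)
      have v1 := vanish ((clusterInEvent ends t 𝓥)ᶜ ∩ clusterInEvent ends s 𝓦 ∩ connEvent ends s u ∩
        (connEvent ends s t)ᶜ) (fun ω hω => ⟨hω.1.2, hω.2⟩)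
      have v2 := vanish (connEvent ends s u ∩ clusterInEvent ends t {W : Set V | o ∈ W} ∩
        (connEvent ends s t)ᶜ) (fun ω hω => ⟨hω.1.1, hω.2⟩)
      have v3 := vanish (clusterInEvent ends t {W : Set V | o ∈ W} ∩
        ((clusterInEvent ends t 𝓥)ᶜ ∩ clusterInEvent ends s 𝓦) ∩ connEvent ends s u ∩
        (connEvent ends s t)ᶜ) (fun ω hω => ⟨hω.1.2, hω.2⟩)
      have h1 := bhk_mixed_cluster_avoid p hp ends s t (X := {t, u}) (by simp)
        (isUpperSet_memFamily o) h𝓦 h𝓥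
      rw [avoidAll_pair] at h1
      rw [genplus_reduction_degenerate' hw.symm haHzero.symm v1 v2 v3]
      have hqN : prob p (connEvent ends s t)ᶜ =
          prob p ((connEvent ends s t)ᶜ ∩ (connEvent ends s u)ᶜ) := by
        rw [← hq, ← haHzero, zero_add]
      refine mul_nonneg hq0 ?_
      rw [hqN]
      linarith [h1]
  · -- `P(u ∉ C_s, Q) = 0`: the masses inside `Q ∩ Uᶜ` vanish; `N_W = q · T_c(W)`
    have vanish : ∀ A : Set (Config E), A ⊆ (connEvent ends s t)ᶜ ∩ (connEvent ends s u)ᶜ →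
        prob p A = 0 := fun A hA =>
      le_antisymm (haNzero ▸ prob_mono hp hA) (prob_nonneg hp A)
    have v1 := vanish (clusterInEvent ends s 𝓦 ∩ (clusterInEvent ends t 𝓥)ᶜ ∩
      ((connEvent ends s t)ᶜ ∩ (connEvent ends s u)ᶜ)) (fun ω hω => hω.2)
    have v2 := vanish (clusterInEvent ends s {W : Set V | o ∈ W} ∩
      ((connEvent ends s t)ᶜ ∩ (connEvent ends s u)ᶜ)) (fun ω hω => hω.2)
    have v3 := vanish (clusterInEvent ends s ({W : Set V | o ∈ W} ∩ 𝓦) ∩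
      (clusterInEvent ends t 𝓥)ᶜ ∩ ((connEvent ends s t)ᶜ ∩ (connEvent ends s u)ᶜ))
      (fun ω hω => hω.2)
    rw [genplus_reduction_degenerate hq.symm hw.symm ho.symm haNzero.symm v1 v2 v3]
    exact mul_nonneg hq0 hc

end GenPlusContain

end Summit.Ventures.PercRepro2
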